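import Summits.BirchSwinnertonDyer.Rank1Residual.Additive.MinimalGoodOrdinaryField
import Literature.NumberTheory.NumberFields.OddDegreeUnramifiedNoQuadraticSubfield
import Literature.NumberTheory.QuadraticFields.HeegnerCondition
import HarnessLib

/-!
# X3♯(G-ord) / X4♯(G-ord), defect 2: over EVERY quadratic field ramified at `p` the over-`K` datum `E_K` is GOOD ORDINARY at the RAMIFIED prime

HONEST FRAMING (cell `b2b-bsdres`, run/shared/lean/b2b/bsd-rank1-residual/, verbatim in every
file): the goal of the cell is to DELETE the COMBINATION-SHAPED residual classes of the
Birch–Swinnerton-Dyer formula for ALL analytic-rank `≤ 1` elliptic curves over `ℚ` — "full BSD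
formula for every rank `≤ 1` curve in class `C`" assembled STRICTLY from published theorems — so
that the rank-`≤ 1` remainder becomes exactly the CONSTRUCTION-SHAPED classes, which are TYPED
(missing-input `Prop`s), NOT attempted. This is not "finishing BSD". Sub-cell `additive-p2`
(CLASS-OWNERS row "X3/X4 additive — pot. good ordinary / X3♯(G-ord)"), generation 6: research
route; no claim beyond the stated classes; theorems only, no definition, no new named fact;
X3♯(G-ord)/X4♯(G-ord) stay CONSTRUCTION-SHAPED.

WHAT THIS FILE DOES. The defect-2 class theorems of the sub-cell (`GordDescentModelFree.lean`:
`bsdp_iff_overC_of_classX4Gord_two_of_surj`, `bsdp_of_classX4Gord_two_of_surj`;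
`GordDescentModelFreeCases.lean`: `bsdp_of_classX3Gord_two_cases`, `bsdp_iff_lowerOverC_…_of_kim`)
reduce `BSD(E,p)` on X3♯(G-ord)/X4♯(G-ord) ∩ `I₀*` to ONE typed input,
`AdditivePotMult.MissingPPartOverCAt (W.baseChange K) p` — the `p`-part of BSD for `E_K` over ANY
quadratic field `K` with `d_K = p*`. That predicate's docstring describes the X3♯(M)/X4(M) route,
where `E_K` is MULTIPLICATIVE above `p`. This file certifies, in the kernel, the local type of the
over-`K` datum in THIS sub-cell's route, and that the route's domain is exactly the `I₀*` cell:

* `ramificationIdx_eq_two_of_dvd_discr` — in a quadratic `K` with `p ∣ d_K` every `w ∋ p` has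
  `e(w|p) = 2` (tree `ramificationIdx_eq_two_of_dvd_discr_of_finrank_eq_two`, restated in the
  `ramificationIdx'` currency of gen 4's criterion);
* `hasGoodReductionAt_baseChange_quadratic_iff_dvd_two` / `…_iff_eq_two` — `p ≥ 5`, `W` globally
  minimal, `ord_p j ≥ 0`, `K` quadratic with `p ∣ d_K`: **`E_K` good at `w ∋ p` iff `e_E(p) ∣ 2`**,
  i.e. for `E` additive at `p` **iff `e_E(p) = 2`** (gen 4's
  `hasGoodReductionAt_baseChange_iff_semistabilityIndex_dvd` at `e(w|p) = 2`);
* `dvd_discr_of_addv_of_hasGoodReductionAt_baseChange` — for ANY number field `K`: if `E` is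
  additive at `p` and `E_K` is good at `w ∋ p` then **`p ∣ d_K`** (`e(w|p) ≥ 2`, gen 4, and
  Dedekind's discriminant theorem, Mathlib `NumberField.not_dvd_discr_iff_forall_mem`);
  `hasGoodReductionAt_baseChange_quadratic_iff` — over a quadratic `K`: **`E_K` good at `w ∋ p` iff
  (`e_E(p) = 2` and `p ∣ d_K`)**: the quadratic descent has EXACTLY the `I₀*` cell as its domain and
  EXACTLY the quadratic fields ramified at `p` as its fields;
* `TypeGOrd.good_and_unitRoot_baseChange_quadratic_pStar` (+ `ClassX4Gord.…`, `ClassX3Gord.…`,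
  `TypeGOrd.good_unitRoot_ramified_baseChange_quadratic_pStar`) — **for a (G)-ordinary defect-2
  pair (`p ≥ 5`) and ANY quadratic `K` with `d_K = p*`, the curve `W.baseChange K` of the typed
  input is GOOD with the UNIT-ROOT (ordinary) condition at every `w ∋ p`, and `e(w|p) = 2`**
  (`√p* ∈ K` by the tree's `Quadratic.exists_sq_eq_discr`; `E_K ≅ (E^{(p*)})_K`; the twist is good
  ordinary over `ℚ` by gen 4's `exists_goodOrd_twist_pStar_of_typeGOrd`; good ordinary reduction
  ascends, gen 0, and is an isomorphism invariant); conversely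
  `semistabilityIndex_eq_two_of_hasGoodReductionAt_baseChange_quadratic_pStar`.

CONSEQUENCE FOR THE LOCATED GAP (AUDIT-X34-GORD.md §2–§4, unchanged): the ONE missing input of the
`I₀*` cell is, exactly, the `p`-part of BSD for an elliptic curve over a (real or imaginary)
quadratic field at a prime `𝔭` with `e(𝔭|p) = 2` where the curve is GOOD ORDINARY — the hypothesis
shape that the printed over-`K` theorems exclude: X. Wan, Forum Math. Sigma 3 (2015) e18 §1.1 and
Burungale–Castella–Skinner, IMRN 2025 §2.1 (ur) require `p` UNRAMIFIED in the totally real field;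
Bertolini–Darmon–Prasanna / Jetchev–Skinner–Wan require `p` SPLIT in the imaginary quadratic field;
W. Zhang, Camb. J. Math. 2 (2014) requires `p ∤ D_K N`. Nothing is booked; labels, census
(X3♯(G-ord) 334 ‖ 191, X4♯(G-ord) 946 ‖ 240; `I₀*` cell 681 pairs at N < 2·10⁴) UNCHANGED.

References: D. Delbourgo, Compositio Math. 113 (1998) §1.5 (G), Thm 3, Prop 4; J. S. Milne,
Invent. Math. 17 (1972) 177–190 (Weil restriction; the descent identity used by `GordDescent*.lean`);
D. A. Marcus, *Number Fields*, Ch. 2, Thm. 1 (`√d_K ∈ 𝓞 K`); J. Neukirch, *Algebraic Number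
Theory*, III (2.12) (Dedekind: `p ∣ d_K ⟺ p` ramified); J. H. Silverman, *AEC* VII.5.1, VII.5.4,
X.2 Prop. 2.4 (twisting isomorphism); X. Wan (2015) §1.1; A. Burungale, F. Castella, C. Skinner,
IMRN 2025 §2.1; W. Zhang, Camb. J. Math. 2 (2014) p. 5.
-/

noncomputable section

open scoped Classical NumberField

open WeierstrassCurve IsDedekindDomain IsDedekindDomain.HeightOneSpectrum NumberField
  Rat.HeightOneSpectrum Literature.NumberTheory.EllipticCurves
  Literature.NumberTheory.EllipticCurves.Rank1Residual

namespace Summit.BirchSwinnertonDyer.Rank1Residual.Additive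

/-! ### Over an arbitrary quadratic field: good above `p` iff defect `2` and `p` ramified; the over-`K` datum is good ordinary -/

section Quadratic

variable (W : WeierstrassCurve ℚ) [W.IsElliptic] [W.IsGloballyMinimal] (p : ℕ) [hp : Fact p.Prime]
  (K : Type) [Field K] [NumberField K] (w : HeightOneSpectrum (𝓞 K))

omit [NumberField K] in
/-- The ideal `(p) ⊆ ℤ` below `w ∋ p` is nonzero (bookkeeping). -/
private theorem span_natCast_ne_bot : Ideal.span {(p : ℤ)} ≠ ⊥ := by
  rw [Ne, Ideal.span_singleton_eq_bot]; exact_mod_cast hp.out.ne_zero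

/-- At an ADDITIVE potentially good `p ≥ 5`, `e_E(p) ∣ 2 ↔ e_E(p) = 2` (`e_E(p) ≠ 1`, gen 3's
`semistabilityIndex_ne_one_of_addv`; bookkeeping, also in `CyclotomicQuadraticSubfield.lean`). -/
private theorem semistabilityIndex_dvd_two_iff_of_addv (hp5 : 5 ≤ p) (hadd : Addv W p)
    (hj : 0 ≤ padicValRat p W.j) : semistabilityIndex W p ∣ 2 ↔ semistabilityIndex W p = 2 := by
  refine ⟨fun h => ?_, fun h => by rw [h]⟩
  have hne1 := semistabilityIndex_ne_one_of_addv W p hp5 hadd hj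
  have hle : semistabilityIndex W p ≤ 2 := Nat.le_of_dvd two_pos h
  interval_cases hsi : semistabilityIndex W p
  · have h12 := semistabilityIndex_dvd_twelve W p
    rw [hsi] at h12
    norm_num at h12
  · exact absurd rfl hne1
  · rfl

/-- **In a quadratic field `K` with `p ∣ d_K`, every prime `w ∋ p` has `e(w|p) = 2`** (the tree's
`ramificationIdx_eq_two_of_dvd_discr_of_finrank_eq_two`, restated in the `ramificationIdx'`
currency of this sub-cell's criterion `hasGoodReductionAt_baseChange_iff_semistabilityIndex_dvd`).
In particular for the descent field of `GordDescent*.lean` (`d_K = p*`). -/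
theorem ramificationIdx_eq_two_of_dvd_discr (h2 : Module.finrank ℚ K = 2)
    (hdvd : (p : ℤ) ∣ NumberField.discr K) (hw : (p : 𝓞 K) ∈ w.asIdeal) :
    (Ideal.span {(p : ℤ)}).ramificationIdx' w.asIdeal = 2 := by
  haveI := liesOver_span_of_natCast_mem p K w hw
  haveI := w.isMaximal
  rw [Ideal.ramificationIdx'_eq_ramificationIdx _ _ (span_natCast_ne_bot p)]
  exact Literature.NumberTheory.NumberFields.ramificationIdx_eq_two_of_dvd_discr_of_finrank_eq_two
    h2 (Nat.prime_iff_prime_int.mp hp.out) hdvd w.asIdeal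

/-- **Over a quadratic field ramified at `p`, `E_K` is good at `w ∣ p` iff `e_E(p) ∣ 2`** (`p ≥ 5`,
`ord_p j ≥ 0`, `W` globally minimal; ANY quadratic `K` with `p ∣ d_K`, any `K`). -/
theorem hasGoodReductionAt_baseChange_quadratic_iff_dvd_two (hp5 : 5 ≤ p)
    (hj : 0 ≤ padicValRat p W.j) (h2 : Module.finrank ℚ K = 2)
    (hdvd : (p : ℤ) ∣ NumberField.discr K) (hw : (p : 𝓞 K) ∈ w.asIdeal) :
    (W.baseChange K).HasGoodReductionAt w ↔ semistabilityIndex W p ∣ 2 := by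
  rw [hasGoodReductionAt_baseChange_iff_semistabilityIndex_dvd W p K w hp5 hj hw,
    ramificationIdx_eq_two_of_dvd_discr p K w h2 hdvd hw]

/-- **An ADDITIVE potentially good pair becomes good over a quadratic field ramified at `p` iff it
is of defect `2`** (`p ≥ 5`, `W` globally minimal; any quadratic `K` with `p ∣ d_K`, any `w ∋ p`). -/
theorem hasGoodReductionAt_baseChange_quadratic_iff_eq_two (hp5 : 5 ≤ p) (hadd : Addv W p)
    (hj : 0 ≤ padicValRat p W.j) (h2 : Module.finrank ℚ K = 2)
    (hdvd : (p : ℤ) ∣ NumberField.discr K) (hw : (p : 𝓞 K) ∈ w.asIdeal) :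
    (W.baseChange K).HasGoodReductionAt w ↔ semistabilityIndex W p = 2 := by
  rw [hasGoodReductionAt_baseChange_quadratic_iff_dvd_two W p K w hp5 hj h2 hdvd hw,
    semistabilityIndex_dvd_two_iff_of_addv W p hp5 hadd hj]

/-- **Good reduction above an additive `p` forces `p ∣ d_K`** (ANY number field `K`, `p ≥ 5`,
`ord_p j ≥ 0`, `W` globally minimal): if `E` is additive at `p` and `E_K` is good at `w ∋ p` then
`e(w|p) ≥ 2` (`two_le_ramificationIdx_of_addv_of_hasGoodReductionAt`), so `w` is ramified over `p`
and `p` divides the discriminant of `K` (Dedekind; Mathlib `NumberField.not_dvd_discr_iff_forall_mem`,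
`Ideal.ramificationIdx_eq_one`). The kernel form of "every field semistabilising an additive prime
ramifies there" on the discriminant. -/
theorem dvd_discr_of_addv_of_hasGoodReductionAt_baseChange (hp5 : 5 ≤ p) (hadd : Addv W p)
    (hj : 0 ≤ padicValRat p W.j) (hw : (p : 𝓞 K) ∈ w.asIdeal)
    (hgood : (W.baseChange K).HasGoodReductionAt w) : (p : ℤ) ∣ NumberField.discr K := by
  by_contra hnd
  have hpZ : Prime (p : ℤ) := Nat.prime_iff_prime_int.mp hp.out
  haveI := w.isPrime
  haveI : Algebra.IsUnramifiedAt ℤ w.asIdeal :=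
    (NumberField.not_dvd_discr_iff_forall_mem K (𝓞 K) hpZ).mp hnd w.asIdeal inferInstance
      (by rw [Int.cast_natCast]; exact hw)
  haveI := liesOver_span_of_natCast_mem p K w hw
  have h1 : (Ideal.span {(p : ℤ)}).ramificationIdx' w.asIdeal = 1 := by
    rw [Ideal.ramificationIdx'_eq_ramificationIdx _ _ (span_natCast_ne_bot p)]
    exact Ideal.ramificationIdx_eq_one w.asIdeal ℤ
  have h2 := two_le_ramificationIdx_of_addv_of_hasGoodReductionAt W p K w hp5 hadd hj hw hgood
  omega

/-- **Over a quadratic field: `E_K` good at `w ∋ p` iff (defect `2` and `p ∣ d_K`)** for an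
ADDITIVE potentially good pair (`p ≥ 5`, `W` globally minimal) — the domain of the quadratic
descent of `GordDescent*.lean` is exactly the `I₀*` cell, over exactly the quadratic fields ramified
at `p`. -/
theorem hasGoodReductionAt_baseChange_quadratic_iff (hp5 : 5 ≤ p) (hadd : Addv W p)
    (hj : 0 ≤ padicValRat p W.j) (h2 : Module.finrank ℚ K = 2) (hw : (p : 𝓞 K) ∈ w.asIdeal) :
    (W.baseChange K).HasGoodReductionAt w ↔
      semistabilityIndex W p = 2 ∧ (p : ℤ) ∣ NumberField.discr K := by
  constructor
  · intro hgood
    have hdvd := dvd_discr_of_addv_of_hasGoodReductionAt_baseChange W p K w hp5 hadd hj hw hgood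
    exact ⟨(hasGoodReductionAt_baseChange_quadratic_iff_eq_two W p K w hp5 hadd hj h2 hdvd hw).mp
      hgood, hdvd⟩
  · rintro ⟨he, hdvd⟩
    exact (hasGoodReductionAt_baseChange_quadratic_iff_eq_two W p K w hp5 hadd hj h2 hdvd hw).mpr he

/-! #### The over-`K` datum of the defect-2 class theorems: `d_K = p*` -/

omit [W.IsElliptic] [W.IsGloballyMinimal] in
/-- **`W_K ≅ (W^{(d)})_K` when `d` is a square in `K`**: for `k ∈ K` with `k² = d ≠ 0` there is a
change of variables over `K` carrying `W_K` to the base change of the quadratic twist `W^{(d)}`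
(the twisting isomorphism `(x, y) ↦ (x, y/√d)` up to the normal form of `quadraticTwist`; tree
`exists_variableChange_quadraticTwist_one`, `exists_variableChange_quadraticTwist_mul_sq`,
`map_quadraticTwist`). -/
theorem exists_variableChange_baseChange_eq_quadraticTwist {d : ℚ} {k : K}
    (hk : k ^ 2 = algebraMap ℚ K d) (hk0 : k ≠ 0) :
    ∃ C : VariableChange K, C • W.baseChange K = (W.quadraticTwist d).baseChange K := by
  have hd : (algebraMap ℚ K) d = 1 * k ^ 2 := by rw [one_mul, hk]
  have htw : (W.quadraticTwist d).baseChange K = (W.baseChange K).quadraticTwist (1 * k ^ 2) := by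
    rw [← hd]
    exact map_quadraticTwist W (algebraMap ℚ K) d
  haveI : NeZero (2 : K) := ⟨two_ne_zero⟩
  obtain ⟨C₁, hC₁⟩ := exists_variableChange_quadraticTwist_one (W.baseChange K)
  obtain ⟨C₂, hC₂⟩ := exists_variableChange_quadraticTwist_mul_sq (W.baseChange K) 1 k hk0
  exact ⟨C₂ * C₁, by rw [mul_smul, hC₁, hC₂, htw]⟩

omit [W.IsGloballyMinimal] in
/-- **Transport of good ORDINARY reduction to `E_K` along the twisting isomorphism.** If `√d ∈ K`
and some globally minimal model `Wd ≅ W^{(d)}` over `ℚ` is good ordinary at `p` (`GoodOrd Wd p`),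
then `W_K` is good with the unit-root condition at every `w ∋ p` of `K` (any number field `K`, any
prime `p`): `Wd` good ordinary at the place `v ∋ p` of `ℚ`, hence `Wd_K` good (tree
`hasGoodReductionAt_baseChange_of_hasGoodReductionAt`) and ordinary (gen 0's
`hasUnitRootAt_baseChange_of_hasGoodReductionAt`, `a_w ≡ a_v^f`) at `w`, and
`W_K ≅ (W^{(d)})_K ≅ Wd_K` (`exists_variableChange_baseChange_eq_quadraticTwist`; good reduction and
the unit-root condition are isomorphism invariants). -/
theorem good_and_unitRoot_baseChange_of_goodOrd_twist_of_sq_eq {d : ℚ} {k : K}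
    (hk : k ^ 2 = algebraMap ℚ K d) (hk0 : k ≠ 0) (Wd : WeierstrassCurve ℚ) [Wd.IsElliptic]
    [Wd.IsGloballyMinimal] (C₀ : VariableChange ℚ) (hWd : C₀ • W.quadraticTwist d = Wd)
    (hord : GoodOrd Wd p) (hw : (p : 𝓞 K) ∈ w.asIdeal) :
    (W.baseChange K).HasGoodReductionAt w ∧ (W.baseChange K).HasUnitRootAt w := by
  set v : HeightOneSpectrum (𝓞 ℚ) := (primesEquiv (R := 𝓞 ℚ)).symm ⟨p, hp.out⟩ with hvdef
  have hpv : (p : 𝓞 ℚ) ∈ v.asIdeal :=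
    (natCast_mem_asIdeal_iff_eq_primesEquiv_symm v hp.out).mpr rfl
  have hwv : w.asIdeal.under (𝓞 ℚ) = v.asIdeal := under_eq_asIdeal_of_natCast_mem p w hw
  haveI : w.asIdeal.LiesOver v.asIdeal := ⟨hwv.symm⟩
  -- `Wd` good ordinary at `v`, hence `Wd_K` good with unit root at `w`
  obtain ⟨hgv, huv⟩ := Wd.hasGoodReductionAt_and_hasUnitRootAt_of_rat hord.1 hord.2 v hpv
  have hgw : (Wd.baseChange K).HasGoodReductionAt w :=
    hasGoodReductionAt_baseChange_of_hasGoodReductionAt Wd K v w hgv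
  have huw : (Wd.baseChange K).HasUnitRootAt w :=
    hasUnitRootAt_baseChange_of_hasGoodReductionAt Wd K p hpv hwv hgv huv
  -- `W_K ≅ (W^{(d)})_K ≅ Wd_K`
  obtain ⟨C, hC⟩ := exists_variableChange_baseChange_eq_quadraticTwist W K hk hk0
  have hWdK : Wd.baseChange K = (C₀.map (algebraMap ℚ K)) • (W.quadraticTwist d).baseChange K := by
    rw [← hWd, baseChange, baseChange, ← map_variableChange]
  have hiso : (C₀.map (algebraMap ℚ K) * C) • W.baseChange K = Wd.baseChange K := by
    rw [mul_smul, hC, hWdK]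
  have hgW : (W.baseChange K).HasGoodReductionAt w := by
    rw [← hasGoodReductionAt_smul_iff_holds w (W.baseChange K) (C₀.map (algebraMap ℚ K) * C), hiso]
    exact hgw
  haveI : (W.baseChange K).IsElliptic := by rw [baseChange]; infer_instance
  refine ⟨hgW, ?_⟩
  rw [← hasUnitRootAt_smul_iff (W.baseChange K) (C₀.map (algebraMap ℚ K) * C) w hgW, hiso]
  exact huw

omit [W.IsElliptic] [W.IsGloballyMinimal] hp w in
/-- **A quadratic field of discriminant `p*` contains `√p*`**: some `k ∈ K` has `k² = p*` in `K`
(`√d_K ∈ 𝓞 K` for every quadratic field, tree `Quadratic.exists_sq_eq_discr`; Marcus, *Number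
Fields*, Ch. 2, Thm. 1), and `k ≠ 0`. -/
theorem exists_sq_eq_pStar_of_discr_eq (h2 : Module.finrank ℚ K = 2)
    (hdK : (NumberField.discr K : ℚ) = (-1 : ℚ) ^ (p / 2) * p) :
    ∃ k : K, k ^ 2 = algebraMap ℚ K ((-1 : ℚ) ^ (p / 2) * p) ∧ k ≠ 0 := by
  obtain ⟨-, -, δ, -, hδ⟩ := Literature.NumberTheory.QuadraticFields.Quadratic.exists_sq_eq_discr h2
  refine ⟨(δ : K), ?_, ?_⟩
  · rw [← hdK, map_intCast]
    have h := congrArg (algebraMap (𝓞 K) K) hδ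
    rwa [map_pow, map_intCast] at h
  · intro h0
    have h := congrArg (algebraMap (𝓞 K) K) hδ
    rw [map_pow, map_intCast] at h
    have h' : ((δ : K)) ^ 2 = (NumberField.discr K : K) := h
    rw [h0, zero_pow two_ne_zero] at h'
    have hd0 : (NumberField.discr K : K) ≠ 0 := by exact_mod_cast NumberField.discr_ne_zero K
    exact hd0 h'.symm

omit [W.IsElliptic] [W.IsGloballyMinimal] hp w in
/-- `d_K = p*` (as a rational) gives `p ∣ d_K` (as integers). -/
theorem natCast_dvd_discr_of_discr_eq (hdK : (NumberField.discr K : ℚ) = (-1 : ℚ) ^ (p / 2) * p) :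
    (p : ℤ) ∣ NumberField.discr K := by
  have h : NumberField.discr K = (-1 : ℤ) ^ (p / 2) * p := by exact_mod_cast hdK
  rw [h]
  exact Dvd.intro_left _ rfl

/-- **THE OVER-`K` DATUM OF THE DEFECT-2 CLASS THEOREMS IS GOOD ORDINARY AT THE RAMIFIED PRIME.**
For `(E, p)` (G)-ordinary of defect `2` (`TypeGOrd W p`, `e_E(p) = 2`; e.g. X3♯(G-ord)/X4♯(G-ord)
∩ `I₀*`), `p ≥ 5`, `W` globally minimal, and ANY quadratic field `K` with `d_K = p*` — the field of
`bsdp_iff_overC_of_classX4Gord_two_of_surj`, `bsdp_of_classX3Gord_two_cases`, … — the curve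
`W.baseChange K` of the typed input `MissingPPartOverCAt (W.baseChange K) p` has GOOD reduction
with the UNIT-ROOT (ordinary) condition at every prime `w ∋ p` of `K`, and `e(w|p) = 2`
(`ramificationIdx_eq_two_of_dvd_discr`). So the one missing input of the sub-cell is, exactly, the
`p`-part of BSD for an elliptic curve over a quadratic field at a RAMIFIED prime of GOOD ORDINARY
reduction — the hypothesis shape no published over-`K` theorem reaches (Wan 2015 §1.1 / BCS 2025
§2.1: `p` unramified in `F`; BDP/JSW/Zhang 2014: `p` split resp. `p ∤ D_K`; located gap,
AUDIT-X34-GORD.md §2–§4). Proof: `√p* ∈ K` (`exists_sq_eq_pStar_of_discr_eq`), the good ordinary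
twist `E^{(p*)}` of gen 4 (`exists_goodOrd_twist_pStar_of_typeGOrd`), and
`good_and_unitRoot_baseChange_of_goodOrd_twist_of_sq_eq`. -/
theorem TypeGOrd.good_and_unitRoot_baseChange_quadratic_pStar (hp5 : 5 ≤ p) (hG : TypeGOrd W p)
    (he : semistabilityIndex W p = 2) (h2 : Module.finrank ℚ K = 2)
    (hdK : (NumberField.discr K : ℚ) = (-1 : ℚ) ^ (p / 2) * p) (hw : (p : 𝓞 K) ∈ w.asIdeal) :
    (W.baseChange K).HasGoodReductionAt w ∧ (W.baseChange K).HasUnitRootAt w := by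
  obtain ⟨k, hk, hk0⟩ := exists_sq_eq_pStar_of_discr_eq p K h2 hdK
  obtain ⟨Wd, iWd, iWdm, C₀, hC₀, hord⟩ := exists_goodOrd_twist_pStar_of_typeGOrd W p hp5 hG he
  exact good_and_unitRoot_baseChange_of_goodOrd_twist_of_sq_eq W p K w hk hk0 Wd C₀ hC₀ hord hw

/-- The same with the ramification index recorded: **good, ordinary, and `e(w|p) = 2`** at every
`w ∋ p` of a quadratic `K` with `d_K = p*`, for a (G)-ordinary defect-2 pair at `p ≥ 5`. -/
theorem TypeGOrd.good_unitRoot_ramified_baseChange_quadratic_pStar (hp5 : 5 ≤ p)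
    (hG : TypeGOrd W p) (he : semistabilityIndex W p = 2) (h2 : Module.finrank ℚ K = 2)
    (hdK : (NumberField.discr K : ℚ) = (-1 : ℚ) ^ (p / 2) * p) (hw : (p : 𝓞 K) ∈ w.asIdeal) :
    (W.baseChange K).HasGoodReductionAt w ∧ (W.baseChange K).HasUnitRootAt w ∧
      (Ideal.span {(p : ℤ)}).ramificationIdx' w.asIdeal = 2 := by
  obtain ⟨hg, hu⟩ := TypeGOrd.good_and_unitRoot_baseChange_quadratic_pStar W p K w hp5 hG he h2 hdK hw
  exact ⟨hg, hu, ramificationIdx_eq_two_of_dvd_discr p K w h2 (natCast_dvd_discr_of_discr_eq p K hdK) hw⟩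

/-- **X4♯(G-ord) ∩ `I₀*`: the over-`K` datum is good ordinary at the ramified prime** (`p ≥ 5`; the
class of `bsdp_iff_overC_of_classX4Gord_two_of_surj` / `bsdp_of_classX4Gord_two_cases`). -/
theorem ClassX4Gord.good_and_unitRoot_baseChange_quadratic_pStar (hp5 : 5 ≤ p)
    (hX : ClassX4Gord W p) (he : semistabilityIndex W p = 2) (h2 : Module.finrank ℚ K = 2)
    (hdK : (NumberField.discr K : ℚ) = (-1 : ℚ) ^ (p / 2) * p) (hw : (p : 𝓞 K) ∈ w.asIdeal) :
    (W.baseChange K).HasGoodReductionAt w ∧ (W.baseChange K).HasUnitRootAt w :=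
  TypeGOrd.good_and_unitRoot_baseChange_quadratic_pStar W p K w hp5 hX.typeGOrd he h2 hdK hw

/-- **X3♯(G-ord) ∩ `I₀*`: the over-`K` datum is good ordinary at the ramified prime** (`p ≥ 5`; the
class of `bsdp_of_classX3Gord_two_cases`). -/
theorem ClassX3Gord.good_and_unitRoot_baseChange_quadratic_pStar (hp5 : 5 ≤ p)
    (hX : ClassX3Gord W p) (he : semistabilityIndex W p = 2) (h2 : Module.finrank ℚ K = 2)
    (hdK : (NumberField.discr K : ℚ) = (-1 : ℚ) ^ (p / 2) * p) (hw : (p : 𝓞 K) ∈ w.asIdeal) :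
    (W.baseChange K).HasGoodReductionAt w ∧ (W.baseChange K).HasUnitRootAt w :=
  TypeGOrd.good_and_unitRoot_baseChange_quadratic_pStar W p K w hp5 hX.typeGOrd he h2 hdK hw

/-- Conversely, **if the over-`K` datum is good at some `w ∋ p` for a quadratic `K` with `d_K = p*`,
the pair has defect `2`** (additive, `p ≥ 5`): the class theorems' hypothesis `e_E(p) = 2` is forced
by — not merely sufficient for — good reduction of `E_K` above `p`. -/
theorem semistabilityIndex_eq_two_of_hasGoodReductionAt_baseChange_quadratic_pStar (hp5 : 5 ≤ p)
    (hadd : Addv W p) (hj : 0 ≤ padicValRat p W.j) (h2 : Module.finrank ℚ K = 2)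
    (hdK : (NumberField.discr K : ℚ) = (-1 : ℚ) ^ (p / 2) * p) (hw : (p : 𝓞 K) ∈ w.asIdeal)
    (hgood : (W.baseChange K).HasGoodReductionAt w) : semistabilityIndex W p = 2 :=
  (hasGoodReductionAt_baseChange_quadratic_iff_eq_two W p K w hp5 hadd hj h2
    (natCast_dvd_discr_of_discr_eq p K hdK) hw).mp hgood

end Quadratic

end Summit.BirchSwinnertonDyer.Rank1Residual.Additive

end
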